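import Summits.QuantumFields.BalabanUV.Beta.GAN24.DerivativeRateTransferJensenMassFreeLocalEnd
import Summits.QuantumFields.BalabanUV.Beta.GAN24.DerivativeRateTransferJensenMassFreeRectangle

/-!
# `BalabanUV.Beta.GAN24.DerivativeRateTransferJensenMassFreeLatticeEnd` — binder row G-an2-4 ∕ (CONV-C), route R6 «VALUES, NOT DERIVATIVES», PART 63:
# THE POLAR PAIR's (STAB)^{cov} ON THE BLOCK LATTICE WITH THE CONVENTION AND LOOP LETTERS DISCHARGED — from a lattice gauge field `R` (orthogonal
# transporters, plaquettes within `p̂`), the COMB block transporters `W` and PART 24's straight chains: THERE ARE orthogonal coarse links `R′(y,μ′)` (the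
# polar links) such that for every coarse form dominated by their covariant bond energy the transported block averaging `Q` satisfies
# `⟨Qu, H_cQu⟩ ≤ (1 + ε)·⟨u, H_f u⟩`, `ε = ε(κ, ϖ, ϖ′; t, r)` with `κ = 4d(L−1)·L·p̂` and `δ = 0` — the only letters left are the block Poincaré data
# `Φ ∕ ϖ ∕ ϖ′` (PART 49 ∕ 55 for trees) (unit b2b-balaban-gan24-p3, gen 44; v1)

NOT IN PRINT; OUR PROOF (for the ROUTE; PART 62 `exists_polarLink_covJensen_massFree_local` + PART 60 `loopDefect_lattice` + PART 24's combinatorics BY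
NAME).  HONEST FRAMING (cell contract, verbatim): «discharging `BetaPertH` makes Bałaban's UV stability UNCONDITIONAL — a real constructive-QFT result; it
is NOT the continuum limit and NOT the Clay problem.»  HONEST DEPENDENCY (verbatim): «continuum YM on T⁴ ⇐ BetaPertH ∧ nine spine estimates (0/9
proved); BetaPertH ⇐ (D1) ∧ (D4) ∧ CAP+tail; G-an2-4 gates asym, D1 and NE2/3/4.»

WHY THIS FILE.  It assembles this generation's four pieces on PART 24's encoding (`(Fin d → ZMod M) × (Fin d → Fin L)`, block weights `[x.1 = y](L^d)⁻¹`,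
straight chains with carry, q-weighted chain multiplicity `L·(L^d)⁻¹`): PART 58 (the polar links exist), PART 59 ∕ 60 (the closed-loop letter on the
block with `D = 2d(L−1)·L·p̂` from the plaquette letter and the comb recursion), PART 61 ∕ 62 (the support-local `δ = 0` END).  RESULT
**`covJensen_polar_lattice_of_plaquettes`**: DATA = `R` orthogonal with `|(R(p,μ′)R(p +_{μ′} 1,μ)R(p +_μ 1,μ′)ᵀR(p,μ)ᵀ − 1)w|² ≤ p̂²|w|²` (`μ′ ≠ μ`),
`W` orthogonal with the COMB RECURSION `W y (y, z[μ ↦ z_μ+1]) = W y (y,z)·R((y,z),μ)` (`z_ν = 0` for `ν > μ`), the averaging identity for `Q`, a fine form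
`H_f ≥ w_f·Σ_{(x,μ)}|R_{(x,μ)}u(x⁺) − u(x)|²`, PART 24's chains `T`, and `2d(L−1)·L·p̂ < 1`; CONCLUSION = ∃ orthogonal `R′` such that for every
`w_c ≥ 0` with `w_c·L·(L·(L^d)⁻¹) ≤ w_f`, every `H_c ≤ w_c·Σ_{(y,μ′)}|R′_{(y,μ′)}v(y + e_{μ′}) − v(y)|²`, every `u` with block Poincaré data `Φ ∕ ϖ ∕ ϖ′` and
all `t, r > 0`: `⟨Qu, H_cQu⟩ ≤ (1 + t + (1+t⁻¹)(1+r)ϖ(2D)² + (1+t⁻¹)(1+r⁻¹)·3(2D)²(1 + ϖ + ϖ′)∕(4 − (2D)²))·⟨u, H_f u⟩`, `D = 2d(L−1)·L·p̂`.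

HONEST SCOPE.  One axis order for the contour (no permutation average as in [CMP 109] (0.11)); `R′` is the orthogonal polar factor in the full
orthogonal group of the colour fibre (PART 58's scope note); `p̂` is a letter (the small-field input), not derived; the Poincaré data are hypotheses (the
taxi-tree instance of PART 49 on this encoding is not typed); nothing of Bałaban's specific operators (`G_k`, `Δ_k`, `Ū`) is instantiated; this is
(STAB)^{cov} for the comb-averaged POLAR pair as a comparison of quadratic forms, not (CONV-C).

WHAT THIS FILE PROVES (0 sorry, 0 `def`, nothing cited): **`covJensen_polar_lattice_of_plaquettes`**.
WHAT IT DOES NOT DO: see HONEST SCOPE; no claim on (CONS) ∕ exact (STAB) ∕ the tower.  SUPPLIER work on route R6 (rank 2, REDUCTION, no seat); no consumer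
of record; NEVER «G-an2-4 closed»; NOT (CONV-C), NOT D1, NOT `BetaPertH`, NOT continuum, NOT Clay.  Records: `HOME/b2b-balaban-gan24-p3/WOODBURY-FIBRE.md` v14.4. -/

noncomputable section

open Matrix Finset Function

namespace Summit.QuantumFields.BalabanUV.Beta.GAN24.DerivativeRateTransferJensenMassFreeLatticeEnd

open Summit.QuantumFields.BalabanUV.Beta.GAN24.DerivativeRateTransferJensenLattice
open Summit.QuantumFields.BalabanUV.Beta.GAN24.DerivativeRateTransferJensenMassFreeRectangle
open Summit.QuantumFields.BalabanUV.Beta.GAN24.DerivativeRateTransferJensenMassFreeLocalEnd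

variable {d L M : ℕ} {o : Type*} [Fintype o] [DecidableEq o]

/-- **`covJensen_polar_lattice_of_plaquettes` — THE POLAR PAIR's MASS-FREE COVARIANT JENSEN INEQUALITY ON THE BLOCK LATTICE, FROM THE PLAQUETTE
LETTER** [our proof].  See the module docstring for the data; `D := 2d(L−1)·L·p̂`. -/
theorem covJensen_polar_lattice_of_plaquettes [NeZero M] (hL : 0 < L)
    {R : ((Fin d → ZMod M) × (Fin d → Fin L)) × Fin d → Matrix o o ℝ} (hR : ∀ e, (R e)ᵀ * R e = 1) {phat : ℝ} (hphat : 0 ≤ phat)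
    (hplaq : ∀ (p : (Fin d → ZMod M) × (Fin d → Fin L)) (μ' μ : Fin d), μ' ≠ μ → ∀ w : o → ℝ,
      ((R (p, μ') *
              R (((p.1 + (((p.2 μ' : ℕ) + 1) / L) • (Pi.single μ' (1 : ZMod M)), update p.2 μ' ⟨((p.2 μ' : ℕ) + 1) % L, Nat.mod_lt _ hL⟩) :
                (Fin d → ZMod M) × (Fin d → Fin L)), μ) *
            (R (((p.1 + (((p.2 μ : ℕ) + 1) / L) • (Pi.single μ (1 : ZMod M)), update p.2 μ ⟨((p.2 μ : ℕ) + 1) % L, Nat.mod_lt _ hL⟩) :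
                (Fin d → ZMod M) × (Fin d → Fin L)), μ'))ᵀ *
          (R (p, μ))ᵀ - 1) *ᵥ w) ⬝ᵥ
        ((R (p, μ') *
              R (((p.1 + (((p.2 μ' : ℕ) + 1) / L) • (Pi.single μ' (1 : ZMod M)), update p.2 μ' ⟨((p.2 μ' : ℕ) + 1) % L, Nat.mod_lt _ hL⟩) :
                (Fin d → ZMod M) × (Fin d → Fin L)), μ) *
            (R (((p.1 + (((p.2 μ : ℕ) + 1) / L) • (Pi.single μ (1 : ZMod M)), update p.2 μ ⟨((p.2 μ : ℕ) + 1) % L, Nat.mod_lt _ hL⟩) :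
                (Fin d → ZMod M) × (Fin d → Fin L)), μ'))ᵀ *
          (R (p, μ))ᵀ - 1) *ᵥ w) ≤ phat ^ 2 * (w ⬝ᵥ w))
    {W : (Fin d → ZMod M) → (Fin d → ZMod M) × (Fin d → Fin L) → Matrix o o ℝ} (hW : ∀ y x, (W y x)ᵀ * W y x = 1)
    (hWstep : ∀ (y : Fin d → ZMod M) (z : Fin d → Fin L) (μ : Fin d) (h : (z μ : ℕ) + 1 < L), (∀ ν, μ < ν → (z ν : ℕ) = 0) →
      W y (y, update z μ ⟨(z μ : ℕ) + 1, h⟩) = W y (y, z) * R ((y, z), μ))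
    {Q : Matrix ((Fin d → ZMod M) × o) (((Fin d → ZMod M) × (Fin d → Fin L)) × o) ℝ}
    (hQ : ∀ (u : ((Fin d → ZMod M) × (Fin d → Fin L)) × o → ℝ) (y : Fin d → ZMod M),
      (fun a => (Q *ᵥ u) (y, a)) = ∑ x, (if x.1 = y then ((L : ℝ) ^ d)⁻¹ else 0) • (W y x *ᵥ fun b => u (x, b)))
    {Hf : Matrix (((Fin d → ZMod M) × (Fin d → Fin L)) × o) (((Fin d → ZMod M) × (Fin d → Fin L)) × o) ℝ} {wf : ℝ}
    (hHf : ∀ u : ((Fin d → ZMod M) × (Fin d → Fin L)) × o → ℝ,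
      wf * ∑ e : ((Fin d → ZMod M) × (Fin d → Fin L)) × Fin d,
        ((R e *ᵥ fun b => u ((e.1.1 + ((((e.1.2 e.2 : ℕ) + 1) / L) • (Pi.single e.2 (1 : ZMod M))),
            update e.1.2 e.2 ⟨((e.1.2 e.2 : ℕ) + 1) % L, Nat.mod_lt _ hL⟩), b)) - fun b => u (e.1, b)) ⬝ᵥ
          ((R e *ᵥ fun b => u ((e.1.1 + ((((e.1.2 e.2 : ℕ) + 1) / L) • (Pi.single e.2 (1 : ZMod M))),
            update e.1.2 e.2 ⟨((e.1.2 e.2 : ℕ) + 1) % L, Nat.mod_lt _ hL⟩), b)) - fun b => u (e.1, b)) ≤ u ⬝ᵥ (Hf *ᵥ u))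
    {T : (Fin d → ZMod M) × Fin d → (Fin d → ZMod M) × (Fin d → Fin L) → ℕ → Matrix o o ℝ} (hT0 : ∀ e' x, T e' x 0 = 1)
    (hT : ∀ e' x i, i < L → T e' x (i + 1) = T e' x i *
      R (((x.1 + (((x.2 e'.2 : ℕ) + i) / L) • (Pi.single e'.2 (1 : ZMod M)),
            update x.2 e'.2 ⟨((x.2 e'.2 : ℕ) + i) % L, Nat.mod_lt _ hL⟩) : (Fin d → ZMod M) × (Fin d → Fin L)), e'.2))
    (hsmall : 2 * (d * ((L : ℝ) - 1)) * (L * phat) < 1) :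
    ∃ R' : (Fin d → ZMod M) × Fin d → Matrix o o ℝ, (∀ e', (R' e')ᵀ * R' e' = 1) ∧
      ∀ (wc : ℝ) (_hwc : 0 ≤ wc) (_hw : wc * L * (L * ((L : ℝ) ^ d)⁻¹) ≤ wf) (Hc : Matrix ((Fin d → ZMod M) × o) ((Fin d → ZMod M) × o) ℝ)
        (_hHc : ∀ v : (Fin d → ZMod M) × o → ℝ, v ⬝ᵥ (Hc *ᵥ v) ≤
          wc * ∑ e' : (Fin d → ZMod M) × Fin d, ((R' e' *ᵥ fun a => v (e'.1 + Pi.single e'.2 1, a)) - fun a => v (e'.1, a)) ⬝ᵥ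
            ((R' e' *ᵥ fun a => v (e'.1 + Pi.single e'.2 1, a)) - fun a => v (e'.1, a)))
        (u : ((Fin d → ZMod M) × (Fin d → Fin L)) × o → ℝ) (Φ : (((Fin d → ZMod M) × (Fin d → Fin L)) × o → ℝ) → (Fin d → ZMod M) → ℝ)
        (ϖ ϖ' : ℝ)
        (_hP : ∀ y, ∑ x, (if x.1 = y then ((L : ℝ) ^ d)⁻¹ else 0) * (((W y x *ᵥ fun b => u (x, b)) - fun a => (Q *ᵥ u) (y, a)) ⬝ᵥ
          ((W y x *ᵥ fun b => u (x, b)) - fun a => (Q *ᵥ u) (y, a))) ≤ Φ u y)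
        (_hΦ : wc * ∑ e' : (Fin d → ZMod M) × Fin d, Φ u (e'.1 + Pi.single e'.2 1) ≤ ϖ * (u ⬝ᵥ (Hf *ᵥ u)))
        (_hΦ' : wc * ∑ e' : (Fin d → ZMod M) × Fin d, Φ u e'.1 ≤ ϖ' * (u ⬝ᵥ (Hf *ᵥ u)))
        (t r : ℝ) (_ht : 0 < t) (_hr : 0 < r),
        (Q *ᵥ u) ⬝ᵥ (Hc *ᵥ (Q *ᵥ u)) ≤
          (1 + t + (1 + t⁻¹) * (1 + r) * ϖ * (2 * (2 * (d * ((L : ℝ) - 1)) * (L * phat))) ^ 2 +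
              (1 + t⁻¹) * (1 + r⁻¹) * (3 * (2 * (2 * (d * ((L : ℝ) - 1)) * (L * phat))) ^ 2 /
                (4 - (2 * (2 * (d * ((L : ℝ) - 1)) * (L * phat))) ^ 2)) * (1 + ϖ + ϖ')) * (u ⬝ᵥ (Hf *ᵥ u)) := by
  haveI : NeZero L := ⟨hL.ne'⟩
  have hD0 : 0 ≤ 2 * (d * ((L : ℝ) - 1)) * (L * phat) := by
    have hL1 : (1 : ℝ) ≤ L := by exact_mod_cast hL
    have : 0 ≤ (L : ℝ) - 1 := by linarith
    positivity
  -- positive weight means `x.1 = y`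
  have hblock : ∀ (y : Fin d → ZMod M) (x : (Fin d → ZMod M) × (Fin d → Fin L)),
      (if x.1 = y then ((L : ℝ) ^ d)⁻¹ else 0) ≠ 0 → x.1 = y := fun y x hx => by
    by_contra h
    exact hx (if_neg h)
  -- the local loop letter in PART 62's letters
  have hloc : ∀ (e' : (Fin d → ZMod M) × Fin d) (x x' : (Fin d → ZMod M) × (Fin d → Fin L)),
      (if x.1 = e'.1 then ((L : ℝ) ^ d)⁻¹ else 0) ≠ 0 → (if x'.1 = e'.1 then ((L : ℝ) ^ d)⁻¹ else 0) ≠ 0 → ∀ w : o → ℝ,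
      (((W e'.1 x * T e' x L *
              (W (e'.1 + Pi.single e'.2 1) (((Equiv.addRight (Pi.single e'.2 (1 : ZMod M))).prodCongr (Equiv.refl (Fin d → Fin L))) x))ᵀ)ᵀ *
            (W e'.1 x' * T e' x' L *
              (W (e'.1 + Pi.single e'.2 1) (((Equiv.addRight (Pi.single e'.2 (1 : ZMod M))).prodCongr (Equiv.refl (Fin d → Fin L))) x'))ᵀ) -
            1) *ᵥ w) ⬝ᵥ
        (((W e'.1 x * T e' x L *
              (W (e'.1 + Pi.single e'.2 1) (((Equiv.addRight (Pi.single e'.2 (1 : ZMod M))).prodCongr (Equiv.refl (Fin d → Fin L))) x))ᵀ)ᵀ *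
            (W e'.1 x' * T e' x' L *
              (W (e'.1 + Pi.single e'.2 1) (((Equiv.addRight (Pi.single e'.2 (1 : ZMod M))).prodCongr (Equiv.refl (Fin d → Fin L))) x'))ᵀ) -
            1) *ᵥ w) ≤ (2 * (d * ((L : ℝ) - 1)) * (L * phat)) ^ 2 * (w ⬝ᵥ w) := by
    intro e' x x' hx hx' w
    obtain ⟨x1, x2⟩ := x
    obtain ⟨x1', x2'⟩ := x'
    have h1 : x1 = e'.1 := hblock e'.1 (x1, x2) hx
    have h1' : x1' = e'.1 := hblock e'.1 (x1', x2') hx'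
    subst h1 h1'
    exact loopDefect_lattice hL hR hphat hplaq hW hWstep hT0 hT e' x2 x2' w
  refine exists_polarLink_covJensen_massFree_local (o := o) (μ := Fin d → ZMod M) (ν := (Fin d → ZMod M) × (Fin d → Fin L))
    (β := ((Fin d → ZMod M) × (Fin d → Fin L)) × Fin d) (β' := (Fin d → ZMod M) × Fin d)
    (q := fun (y : Fin d → ZMod M) (x : (Fin d → ZMod M) × (Fin d → Fin L)) => if x.1 = y then ((L : ℝ) ^ d)⁻¹ else 0)
    (W := W) (Q := Q) (src := fun e : ((Fin d → ZMod M) × (Fin d → Fin L)) × Fin d => e.1)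
    (tgt := fun e : ((Fin d → ZMod M) × (Fin d → Fin L)) × Fin d =>
      ((e.1.1 + ((((e.1.2 e.2 : ℕ) + 1) / L) • (Pi.single e.2 (1 : ZMod M))),
        update e.1.2 e.2 ⟨((e.1.2 e.2 : ℕ) + 1) % L, Nat.mod_lt _ hL⟩) : (Fin d → ZMod M) × (Fin d → Fin L)))
    (R := R) (src' := fun e' : (Fin d → ZMod M) × Fin d => e'.1)
    (tgt' := fun e' : (Fin d → ZMod M) × Fin d => e'.1 + Pi.single e'.2 1) (Hf := Hf) (wf := wf)
    (σ := fun e' : (Fin d → ZMod M) × Fin d => (Equiv.addRight (Pi.single e'.2 (1 : ZMod M))).prodCongr (Equiv.refl (Fin d → Fin L)))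
    (ℓ := L)
    (xs := fun (e' : (Fin d → ZMod M) × Fin d) (x : (Fin d → ZMod M) × (Fin d → Fin L)) (i : ℕ) =>
      ((x.1 + (((x.2 e'.2 : ℕ) + i) / L) • (Pi.single e'.2 (1 : ZMod M)),
        update x.2 e'.2 ⟨((x.2 e'.2 : ℕ) + i) % L, Nat.mod_lt _ hL⟩) : (Fin d → ZMod M) × (Fin d → Fin L)))
    (γ := fun (e' : (Fin d → ZMod M) × Fin d) (x : (Fin d → ZMod M) × (Fin d → Fin L)) (i : ℕ) =>
      (((x.1 + (((x.2 e'.2 : ℕ) + i) / L) • (Pi.single e'.2 (1 : ZMod M)),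
        update x.2 e'.2 ⟨((x.2 e'.2 : ℕ) + i) % L, Nat.mod_lt _ hL⟩) : (Fin d → ZMod M) × (Fin d → Fin L)), e'.2))
    (T := T) (m := L * ((L : ℝ) ^ d)⁻¹) (D := 2 * (d * ((L : ℝ) - 1)) * (L * phat))
    ?_ ?_ hW hR hQ ?hf ?_ ?_ ?_ ?_ ?_ hT0 hT ?_ ?_ hD0 hsmall
  case hf =>
    intro u'
    convert hHf u' using 6
  · exact fun y x => blockWeight_nonneg y x
  · exact fun y => sum_blockWeight y
  · exact fun e' x => blockWeight_pair e'.1 (Pi.single e'.2 1) x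
  · exact fun e' x => chain_zero hL e'.2 x
  · intro e' x
    show _ = ((Equiv.addRight (Pi.single e'.2 (1 : ZMod M))).prodCongr (Equiv.refl (Fin d → Fin L))) x
    rw [chain_end hL e'.2 x]
    rfl
  · exact fun e' x i _ => rfl
  · exact fun e' x i _ => chain_step hL e'.2 x i
  · exact fun e => (sum_chainWeight hL e).le
  · exact hloc

end Summit.QuantumFields.BalabanUV.Beta.GAN24.DerivativeRateTransferJensenMassFreeLatticeEnd

end
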